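import Summits.Ventures.QEC.Census.CSSK1SplitLP
import Summits.Ventures.QEC.Census.CSSNormalFormK1
import HarnessLib

/-!
# The split linear program of the `k = 1` CSS normal form: from `(A, s)` and from a CSS code to the certificates

LADDER-QEC (venture cell `qec`), type-10 lane. Bridge lemmas from qec-type-02's normal form (`Census/CSSNormalFormK1.lean`,
`exists_normalForm`: `(Z) ∀ v, d^Z ≤ wt v + wt(vA + s)`, `(X) ∀ u, ⟨u,s⟩ = 1 → d^X ≤ wt u + wt(Au)`) to the split-weight hypotheses of
`Census/CSSK1SplitLP.lean` (`S = supp s`: `wt(y + s) = (|S| − wt_S y) + wt_{Sᶜ} y`, `⟨u, s⟩ = wt_S(u) mod 2`), the certificate-TABLE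
check `k1CertsCheck b m d certs` (one Farkas certificate for every admissible translate weight `w ∈ [d, m]`, `m = |μ| = n − b`), and the
two refutation forms: `normalForm_false_of_certs` (no `(A, s)` on `κ × μ` with `|κ| = b`) and `css_false_of_certs` (no CSS code on
`n` qubits with `k = 1`, `rank H^Z = b`, `d^Z, d^X ≥ d`). Instances: `Census/CSS/K1LP16*.lean`. [folklore] (weak LP duality).
-/

namespace Summit.Ventures.QEC.Census.CSSK1LP

open Finset Matrix Literature.InformationTheory.Coding Literature.InformationTheory.QuantumCodes

/-! ## 4. From a CSS code with `k = 1` to the split system (via qec-type-02's normal form) -/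

section CSS

variable {κ μ : Type*} [Fintype κ] [Fintype μ] [DecidableEq κ] [DecidableEq μ]

omit [DecidableEq κ] in
/-- `wt_univ = hammingNorm`. [folklore] -/
theorem wtOn_univ (v : κ → ZMod 2) : wtOn univ v = hammingNorm v := rfl

omit [Fintype μ] in
/-- With `S = supp s`: `wt(y + s) = (|S| − wt_S(y)) + wt_{Sᶜ}(y)` (adding `1_S` complements the bits on `S`). [folklore] -/
theorem hammingNorm_add_eq [Fintype μ] (s y : μ → ZMod 2) :
    hammingNorm (y + s) =
      (#(univ.filter fun q => s q ≠ 0) - wtOn (univ.filter fun q => s q ≠ 0) y) + wtOn (univ.filter fun q => s q ≠ 0)ᶜ y := by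
  classical
  set S := (univ : Finset μ).filter fun q => s q ≠ 0 with hS
  have hval : ∀ a : ZMod 2, a ≠ 0 → a = 1 := by decide
  have hflip : ∀ a : ZMod 2, a + 1 ≠ 0 ↔ ¬ a ≠ 0 := by decide
  have honS : ∀ q ∈ S, s q = 1 := fun q hq => hval _ (Finset.mem_filter.mp hq).2
  have hoffS : ∀ q ∈ Sᶜ, s q = 0 := fun q hq => by
    have := Finset.mem_compl.mp hq
    rw [hS, Finset.mem_filter] at this
    simpa using this
  rw [← wtOn_univ, wtOn_univ_eq_add S (y + s)]
  congr 1
  · unfold wtOn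
    have h1 : S.filter (fun q => (y + s) q ≠ 0) = S.filter (fun q => ¬ y q ≠ 0) := by
      ext q
      simp only [Finset.mem_filter, Pi.add_apply, and_congr_right_iff]
      intro hq
      rw [honS q hq, hflip]
    rw [h1]
    have := Finset.card_filter_add_card_filter_not (s := S) (fun q => y q ≠ 0)
    omega
  · unfold wtOn
    congr 1
    ext q
    simp only [Finset.mem_filter, Pi.add_apply, and_congr_right_iff]
    intro hq
    rw [hoffS q hq, add_zero]

omit [DecidableEq μ] in
/-- With `S = supp s`: `u · s = wt_S(u) mod 2`. [folklore] -/
theorem dotProduct_eq_one_of_wtOn (s u : μ → ZMod 2) (h : wtOn (univ.filter fun q => s q ≠ 0) u % 2 = 1) :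
    u ⬝ᵥ s = 1 := by
  classical
  set S := (univ : Finset μ).filter fun q => s q ≠ 0 with hS
  have hval : ∀ a : ZMod 2, a ≠ 0 → a = 1 := by decide
  have hsum : u ⬝ᵥ s = ∑ q ∈ S, u q := by
    rw [dotProduct, ← Finset.sum_filter_add_sum_filter_not univ (fun q => s q ≠ 0)]
    have h2 : ∑ q ∈ univ.filter (fun q => ¬ s q ≠ 0), u q * s q = 0 :=
      Finset.sum_eq_zero fun q hq => by
        have : s q = 0 := by simpa using (Finset.mem_filter.mp hq).2
        rw [this, mul_zero]
    rw [h2, add_zero]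
    exact Finset.sum_congr rfl fun q hq => by rw [hval _ (Finset.mem_filter.mp hq).2, mul_one]
  have hbits : ∑ q ∈ S, u q = ((wtOn S u : ℕ) : ZMod 2) := by
    unfold wtOn
    rw [Finset.card_filter, Nat.cast_sum]
    refine Finset.sum_congr rfl fun q _ => ?_
    by_cases hq : u q = 0
    · simp [hq]
    · simp [hval _ hq]
  rw [hsum, hbits]
  have : ((wtOn S u : ℕ) : ZMod 2) = ((1 : ℕ) : ZMod 2) := (ZMod.natCast_eq_natCast_iff' _ _ 2).mpr (by simpa using h)
  simpa using this

/-- The certificate-table check: for every `w` with `D ≤ w ≤ m` the `(b, w)` split system has a checked Farkas certificate. [folklore] -/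
def k1CertsCheck (b m D : ℕ) (certs : ℕ → List (ℕ × ℕ × ℕ) × List ℚ) : Bool :=
  (List.range (m + 1)).all fun w =>
    decide (w < D) || farkasCheck (k1Rows b w (m - w) D (certs w).1) (certs w).2 (k1N b w (m - w))

/-- **Matrix form.** If every `w ∈ [D, |μ|]` is certified for `b = |κ|`, no pair `(A, s)` on `κ × μ` satisfies the `k = 1`
normal-form conditions `(Z)`, `(X)` at distance `D`. [folklore] -/
theorem normalForm_false_of_certs {b D : ℕ} {certs : ℕ → List (ℕ × ℕ × ℕ) × List ℚ}
    (hcert : k1CertsCheck b (Fintype.card μ) D certs = true) (hb : Fintype.card κ = b)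
    (A : Matrix κ μ (ZMod 2)) (s : μ → ZMod 2)
    (hZ : ∀ v : κ → ZMod 2, D ≤ hammingNorm v + hammingNorm (v ᵥ* A + s))
    (hX : ∀ u : μ → ZMod 2, u ⬝ᵥ s = 1 → D ≤ hammingNorm u + hammingNorm (A *ᵥ u)) : False := by
  classical
  set S := (univ : Finset μ).filter fun q => s q ≠ 0 with hS
  have hw1 : D ≤ #S := by
    have h := hZ 0
    rw [Matrix.zero_vecMul, zero_add, hammingNorm_zero, zero_add] at h
    exact h
  have hw2 : #S ≤ Fintype.card μ := (card_filter_le _ _).trans (card_univ (α := μ)).le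
  have hc : #Sᶜ = Fintype.card μ - #S := Finset.card_compl S
  have hcw : farkasCheck (k1Rows b #S (Fintype.card μ - #S) D (certs #S).1) (certs #S).2
      (k1N b #S (Fintype.card μ - #S)) = true := by
    have := List.all_eq_true.mp hcert #S (List.mem_range.mpr (by omega))
    have hnot : ¬ (#S < D) := by omega
    simpa [hnot] using this
  refine false_of_farkasCheck A S hcw hb rfl hc (fun v => ?_) (fun u hu => ?_)
  · have h := hZ v
    rw [hammingNorm_add_eq s (v ᵥ* A), ← hS, ← wtOn_univ] at h
    omega
  · have h := hX u (dotProduct_eq_one_of_wtOn s u hu)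
    rwa [← wtOn_univ, ← wtOn_univ] at h

variable {RX RZ : Type*} [Fintype RX] [Fintype RZ]

/-- **CSS form.** If every `w ∈ [D, n − b]` is certified, there is no CSS code on `n` qubits with `k = 1`, `rank H^Z = b` and
`d^Z, d^X ≥ D` (qec-type-02's `CSSNormalForm.exists_normalForm` supplies the normal form). [folklore] -/
theorem css_false_of_certs {n b D : ℕ} {certs : ℕ → List (ℕ × ℕ × ℕ) × List ℚ}
    (hcert : k1CertsCheck b (n - b) D certs = true)
    (C : CSSCode RX RZ (Fin n)) (hk : C.k = 1) (hb : C.HZ.rank = b) (hDZ : D ≤ C.dZ) (hDX : D ≤ C.dX) : False := by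
  classical
  obtain ⟨I, A, s, hI, -, hZ, hX⟩ := CSSNormalForm.exists_normalForm C hk
  have hκ : Fintype.card {q // q ∈ I} = b := by rw [Fintype.card_coe, hI, hb]
  have hμ : Fintype.card {q // q ∉ I} = n - b := by
    rw [Fintype.card_subtype_compl, Fintype.card_coe, hI, hb, Fintype.card_fin]
  rw [← hμ] at hcert
  exact normalForm_false_of_certs hcert hκ A s (fun v => hDZ.trans (hZ v)) (fun u hu => hDX.trans (hX u hu))

end CSS

end Summit.Ventures.QEC.Census.CSSK1LP
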